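import Literature.AlgebraicGeometry.Frobenioids.ModelFrobenioidComparisonCocycle
import HarnessLib

/-!
# Frobenioids I, Theorem 5.2 (iv), proof step: the comparison functor is faithful

Mochizuki, *The geometry of Frobenioids I: the general theory*, Kyushu J. Math. **62** (2008)
293–400, §5, proof of Theorem 5.2 (iv), kurims text pp. 102–103 [cite: MochizukiFrdI2008, Thm.
5.2(iv) p.102]:
"Note that these factorizations also imply that this functor `C′ → [model]` is faithful."

If two morphisms `f, g : (X, p) → (X', p')` of `C′` have the same image `(deg, baseOf, divOf, u)`
in the
model Frobenioid, then their conjugates `pathHom` have the same factorisation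
`F(d)^birat ≫ u ≫ π^birat` (the `P`-part depends only on the base map), hence coincide; cancelling
the
path isomorphisms gives `f^birat = g^birat`, and `C → C^birat` is faithful (Prop. 4.4 (ii)).
-/

namespace Literature.AlgebraicGeometry.Frobenioids

open CategoryTheory Opposite

universe w v v' u u'

namespace PreFrobenioid

namespace FPPath

variable {D : Type u} [Category.{v} D] {Φ : Dᵒᵖ ⥤ CommMonCat.{w}}
  {C : Type u'} [Category.{v'} C] {F : C ⥤ ElemFrobenioid Φ} {hF : IsFrobenioid F}
  {hsq : HasBiratSquares F} {P : Presection C} {Fr : ℕ+ →* CategoryTheory.End P.ι} {X X' : C}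

/-- The `P`-part depends only on the base map. [cite: MochizukiFrdI2008, Thm. 5.2(iv) p.102] -/
theorem ppart_congr (hP : IsBaseSection F P) (p : FPPath F {A | P.obj A} X)
    (p' : FPPath F {A | P.obj A} X') {φ φ' : X ⟶ X'} (h : baseOf p p' φ = baseOf p p' φ') :
    ppart hP p p' φ = ppart hP p p' φ' :=
  ppart_unique hP p p' φ' (ppart_mem hP p p' φ) ((base_ppart hP p p' φ).trans h)

/-- The path isomorphism is an isomorphism of `C^birat`. [cite: MochizukiFrdI2008, Thm. 5.2(iv)
p.102] -/
theorem isIso_pathIso (p : FPPath F {A | P.obj A} X) : IsIso (pathIso hF hsq p) := by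
  haveI := Birat.isIso_toBirat_map (hF := hF) (hsq := hsq) p.ζA p.ζA_mem
  haveI := Birat.isIso_toBirat_map (hF := hF) (hsq := hsq) p.ζX p.ζX_mem
  unfold pathIso
  infer_instance

/-- The reversed path isomorphism is an isomorphism of `C^birat`. [cite: MochizukiFrdI2008, Thm.
5.2(iv) p.102] -/
theorem isIso_pathIsoRev (p : FPPath F {A | P.obj A} X) : IsIso (pathIsoRev hF hsq p) := by
  haveI := Birat.isIso_toBirat_map (hF := hF) (hsq := hsq) p.ζA p.ζA_mem
  haveI := Birat.isIso_toBirat_map (hF := hF) (hsq := hsq) p.ζX p.ζX_mem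
  unfold pathIsoRev
  infer_instance

/-- `φ` is recovered from its conjugate: `pathHom φ = pathHom φ' → φ = φ'` (path isomorphisms
cancel,
`C → C^birat` is faithful). [cite: MochizukiFrdI2008, Thm. 5.2(iv) p.102] -/
theorem pathHom_injective (p : FPPath F {A | P.obj A} X) (p' : FPPath F {A | P.obj A} X')
    {φ φ' : X ⟶ X'} (h : pathHom hF hsq p p' φ = pathHom hF hsq p p' φ') : φ = φ' := by
  haveI := isIso_pathIso (hF := hF) (hsq := hsq) p
  haveI := isIso_pathIsoRev (hF := hF) (hsq := hsq) p'
  rw [pathHom_eq, pathHom_eq, cancel_epi] at h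
  have h' := (cancel_mono (pathIsoRev hF hsq p')).mp h
  exact (toBirat_faithful hF hsq).map_injective h'

/-- **The comparison functor is faithful.** [cite: MochizukiFrdI2008, Thm. 5.2(iv) p.102] -/
theorem comparison_faithful (hPF : IsBaseFrobeniusPair F P Fr) (hiso : IsOfIsotropicType F)
    (hbfn : ∀ A : C, IsBiratFrobeniusNormalized F hF hsq A) {B : Dᵒᵖ ⥤ CommMonCat.{w}}
    {DivB : B ⟶ monoidGp Φ} (R : RationalFunctionMonoidStr F hF B DivB) :
    (UnitData.comparison (unitData hF hsq hPF hiso hbfn R)).Faithful := by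
  refine ⟨fun {x y} f g h => ?_⟩
  have hd : degFr F f.hom = degFr F g.hom := congrArg ModelFrobenioid.Hom.degFr h
  have hb : baseOf x.path y.path f.hom = baseOf x.path y.path g.hom :=
    congrArg ModelFrobenioid.Hom.base h
  have hu : (R.iso x.path.A).symm (unitOf hF hsq hPF hiso x.path y.path f.hom) =
      (R.iso x.path.A).symm (unitOf hF hsq hPF hiso x.path y.path g.hom) :=
    congrArg ModelFrobenioid.Hom.unit h
  have hu' := (R.iso x.path.A).symm.injective hu
  apply InducedCategory.hom_ext
  apply pathHom_injective (hF := hF) (hsq := hsq) x.path y.path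
  rw [unitOf_spec hPF hiso x.path y.path f.hom, unitOf_spec hPF hiso x.path y.path g.hom]
  have e1 : x.path.frob Fr (degFr F f.hom) = x.path.frob Fr (degFr F g.hom) := congrArg _ hd
  have e3 : ppart hPF.isBaseSection x.path y.path f.hom =
      ppart hPF.isBaseSection x.path y.path g.hom :=
    ppart_congr hPF.isBaseSection x.path y.path hb
  simp only [hu', e3]
  exact congrArg (fun t => (toBirat F hF hsq).map t ≫
    BiratUnits.toHom hsq (unitOf hF hsq hPF hiso x.path y.path g.hom) ≫
      (toBirat F hF hsq).map (ppart hPF.isBaseSection x.path y.path g.hom)) e1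

end FPPath

end PreFrobenioid

end Literature.AlgebraicGeometry.Frobenioids
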